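import Literature.MathematicalPhysics.QuantumFieldTheory.Balaban1983to89.B13TermWalkDataOneTorus
import Literature.MathematicalPhysics.QuantumFieldTheory.Balaban1983to89.B13Lemma3TorusPrimitivePoly

/-!
# Spine/NE5/TwoRunTorusWalkH226 — (2.26) FOR ONE TERM FROM ONE WALK RECORD at `c⁺`, at a fixed configuration:
# Lemma 3's per-term input READ FROM THE RECORD, independent of the (2.14)∕Cauchy holomorphy layer
# (cell `pub-balaban-gaps`, seat `ne5` gen 9)

WHY.  T25 `TwoRunTorusWalkParam.hol_and_h226_torus_of_termWalkData_param` delivers BOTH torus-chain inputs — holomorphy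
of the term in the parameter (through T21) AND (2.26) uniformly — from one walk record.  Its (2.26) half does not need
T21 at all: it is r10's located capstone `B13Lemma3TorusPrimitivePoly.h226_torus_of_primitives_holo_polyτ` (Literature,
landed) fed with the record's letters.  THIS FILE isolates that half so that it LANDS independently of the (2.14)∕Cauchy
layer's oleans: `h226_of_termWalkData` — for ONE record `𝒦 : TermKernels c⁺ …` over a parameter space `B`, walk objects
`TermWalkData 𝒦 w` with `w.Admissible α Rσ₀`, NODE A's `SmallTheta w α θ`, and ONE configuration `‖u‖ ≤ α`: the
(2.14)-term built from the record's kernels at `u` obeys (2.26) `‖(2.14)‖ ≤ weight·e^{a₅|Z|}`, given the non-walk data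
at `u` (σ-holomorphy of the kernels on the open `e^{κ₁+1}`-polydisc, symmetry and `Re ≻ 0` of the precision there —
the latter derivable from the record by T28 `TwoRunTorusWalkRePos`, the potentials with (2.20), the common `χ` with
(2.22), a column fibre bound, rates and numerics).  Downstream BY NAME (landed): `B13Lemma3TorusTerms.hrep_of_termwise` →
`bound238With_torus` = Lemma 3 (2.38) on the carrier, and (2.41): the ONE-RUN envelopes of NE5 (T16's `hA1 ∕ hB1`) and
(D4) NODE A's Lemma-3 input, per term, from walk records.

HONEST FRAMING.  Pure composition of LANDED shapes (r10's H7 poly-τ capstone; g1-p2's record capstones;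
`B13PrimitiveKernels216.localisation17a_mono_rate`); every record, region, function and number is a HYPOTHESIS; nothing
of Bałaban's `C^{(k)}(Z₀,σ)`, `Γ_k(Z₀,σ)`, `𝐕_k` is constructed or asserted; whether his operators admit such records is
NODE O's statement (v)⁺; NE5 NOT PRINTED ∕ NOT PROVED; leaves 0∕12; (D4) 0∕1; spine 0∕9.  Rung (B)+1 on a FIXED finite
T⁴ — NOT continuum, NOT infinite volume, NOT mass gap, NOT Clay.  0 sorry, 0 `def`.

Sources: [II] = T. Bałaban, CMP **116** (1988) [Balaban1988RG2Cluster] p. 5 (κ₁), p. 13, (2.14)–(2.16) pp. 15–16,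
(2.20)–(2.26) pp. 16–17; [B9] = CMP **99** (1985) [Balaban1985BackgroundPropagators] Thm 3.10 p. 416.  Nothing here is a
claim about the Yang–Mills mass gap.
-/

noncomputable section

namespace Summit.QuantumFields.BalabanUV.T4Continuum.Spine.NE5.TwoRunTorusWalkH226

open Matrix Metric Set Finset
open Literature.MathematicalPhysics.QuantumFieldTheory.Balaban1983to89
open Literature.MathematicalPhysics.QuantumFieldTheory.Balaban1983to89.TreeLengthTorus (TPt TDom tsys)
open Literature.MathematicalPhysics.QuantumFieldTheory.Balaban1983to89.TreeLengthTorusTransfer (tclosure)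
open Literature.MathematicalPhysics.QuantumFieldTheory.Balaban1983to89.B13Lemma3TorusData (TBond)
open Literature.MathematicalPhysics.QuantumFieldTheory.Balaban1983to89.B13Lemma3TorusTerms (weight Z0)
open Literature.MathematicalPhysics.QuantumFieldTheory.Balaban1983to89.B13Term214 (core214 F214 term214)
open Literature.MathematicalPhysics.QuantumFieldTheory.Balaban1983to89.B13Bound143 (invTau)
open Literature.MathematicalPhysics.QuantumFieldTheory.Balaban1983to89.B5TorusCover (UT)
open Literature.MathematicalPhysics.QuantumFieldTheory.Balaban1983to89.B9Thm37GlueTorus (tdist1)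
open Literature.MathematicalPhysics.QuantumFieldTheory.Balaban1983to89.B13PrimitiveKernels216
  (Localisation17a Differences216 localisation17a_mono_rate)
open Literature.MathematicalPhysics.QuantumFieldTheory.Balaban1983to89.B13TermWalkData
  (WalkConsts TermKernels TermWalkData localisation17a_of_termWalkData differences216_of_termWalkData)
open Literature.MathematicalPhysics.QuantumFieldTheory.Balaban1983to89.B13TermWalkDataOneTorus (SmallTheta)
open Literature.MathematicalPhysics.QuantumFieldTheory.Balaban1983to89.B13Lemma3TorusPrimitivePoly
  (h226_torus_of_primitives_holo_polyτ)

variable {d L N' : ℕ} [NeZero L] [NeZero N'] {M : ℕ}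
variable {ν : ℕ} {Nf : Fin ν → ℕ} [∀ i, NeZero (Nf i)]
variable {B : Type*} [NormedAddCommGroup B] [NormedSpace ℂ B]

omit [NeZero N'] in
/-- The open σ-region of the consumer contains the closed polydisc of the physical constants record `c` and sits inside
the closed polydisc of `c⁺ := {c with κ₁ := c.κ₁ + 1}` at which the walk road is run (the three-line glue of junction
(J1)). [cite: Balaban1988RG2Cluster, p.5, p.13] -/
theorem sigma_region_glue (c : B13.Consts) :
    IsOpen (ball (0 : ℂ) (Real.exp (c.κ₁ + 1))) ∧
      closedBall (0 : ℂ) (Real.exp c.κ₁) ⊆ ball (0 : ℂ) (Real.exp (c.κ₁ + 1)) ∧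
      ∀ σ : TPt d N' → ℂ, (∀ j, σ j ∈ ball (0 : ℂ) (Real.exp (c.κ₁ + 1))) →
        ∀ j, ‖σ j‖ ≤ Real.exp ({ c with κ₁ := c.κ₁ + 1 } : B13.Consts).κ₁ :=
  ⟨isOpen_ball, closedBall_subset_ball (Real.exp_lt_exp.2 (by linarith)),
    fun _σ hσ j => (mem_ball_zero_iff.1 (hσ j)).le⟩

open Classical in
/-- **(2.26) FOR ONE TERM FROM ONE WALK RECORD AT `c⁺`, AT A FIXED CONFIGURATION.**  Data: the physical constants `c`, a
term `(Z, t)` with its lists and per-domain τ-regions; ONE record `𝒦 : TermKernels c⁺ d N′ ν Nf B` with `TermWalkData 𝒦 w`,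
`w.Admissible α Rσ₀`, `0 ≤ α`, and ONE configuration `‖u‖ ≤ α`; the Γ-operator at `u` linear with kernel `𝒦.G2 σ u`;
σ-holomorphy of `𝒦.A2 · u`, `𝒦.G2 · u` on the open `e^{κ₁+1}`-polydisc; symmetry and `Re ≻ 0` of `𝒦.A2 σ u` there (the
latter is the record's by T28); potentials `𝐕 Y` measurable with (2.20) on `Π_Y Uτ Y`; common `χ, χᶜ, 𝐃` with (2.22); a
column fibre bound; rates `w.κ > κ_a > κ_b > κ′ > κ″ > 0`; `SmallTheta w α θ`; the p. 17 numerics in the record's letters.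
Conclusion: `‖term214 r lZ lD (core214 (𝒦.A2 · u) Γ (F214 |P| χ χᶜ 𝐃 𝐕)) 0 0‖ ≤ weight L M c Z a t · e^{a₅|Z|}` — r10's
`h226_torus_of_primitives_holo_polyτ` fed by `localisation17a_of_termWalkData` (dropped to `κ_b`),
`differences216_of_termWalkData`; no T21.
[cite: Balaban1988RG2Cluster, p.5, p.13, (2.14)–(2.16) pp.15–16, (2.20)–(2.26) pp.16–17; Balaban1985BackgroundPropagators, Thm 3.10 p.416] -/
theorem h226_of_termWalkData (c : B13.Consts) (hκ₁ : 1 ≤ c.κ₁) (hα₆ : c.α₆ ≠ 0)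
    (Z : TDom d N') (t : Finset (TDom d (L * N')) × Finset (TBond d M (L * N')))
    (hpos : ∀ Y : TDom d (L * N'), 0 < invTau c ((tsys d (L * N')).dj Y))
    (hhalf : ∀ Y : TDom d (L * N'), invTau c ((tsys d (L * N')).dj Y) ≤ 1 / 2)
    {Uτ : TDom d (L * N') → Set ℂ} (hUτ : ∀ Y, IsOpen (Uτ Y))
    (hUtau : ∀ Y : TDom d (L * N'), closedBall (0 : ℂ) ((invTau c ((tsys d (L * N')).dj Y))⁻¹) ⊆ Uτ Y)
    {r : ℝ} (hr : 0 < r) (hr' : r ≤ Real.exp c.κ₁ - 1)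
    (hsubτ : ∀ Y, ∀ s ∈ Set.uIcc (0 : ℝ) 1, closedBall (s : ℂ) r ⊆ Uτ Y)
    (lZ : List (TPt d N')) (hlZ : lZ.Nodup ∧ lZ.toFinset = Z.1 \ tclosure L N' (Z0 M t))
    (lD : List (TDom d (L * N'))) (hlD : lD.Nodup ∧ lD.toFinset = t.1)
    -- THE WALK RECORD OF THE TERM AT `c⁺` OVER THE PARAMETER SPACE (the (D4) walk road's objects, g1-p2's record)
    (𝒦 : TermKernels ({ c with κ₁ := c.κ₁ + 1 } : B13.Consts) d N' ν Nf B) [Fintype 𝒦.C₀] [DecidableEq 𝒦.C₀]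
    {w : WalkConsts} {α Rσ₀ : ℝ} (hw : w.Admissible α Rσ₀) (hα : 0 ≤ α) (h𝒦 : TermWalkData 𝒦 w)
    {u : B} (hu : ‖u‖ ≤ α)
    (Γ : (TPt d N' → ℂ) → (𝒦.Λ ⊕ 𝒦.C₀ → ℝ) → (𝒦.Λ → ℂ))
    (hlin : ∀ σ : TPt d N' → ℂ, (∀ j, σ j ∈ ball (0 : ℂ) (Real.exp (c.κ₁ + 1))) →
      ∀ X : 𝒦.Λ ⊕ 𝒦.C₀ → ℝ, Γ σ X = 𝒦.G2 σ u *ᵥ fun j => (X j : ℂ))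
    (χY₀ χcP : (𝒦.Λ → ℝ) → ℝ) (hχ0 : ∀ Bf, 0 ≤ χY₀ Bf) (hχc0 : ∀ Bf, 0 ≤ χcP Bf) (Dfam : Finset (TDom d (L * N')))
    (Vk : TDom d (L * N') → (𝒦.Λ → ℝ) → ℂ)
    -- what is NOT walk data: σ-holomorphy (NODE O), symmetry ∕ `Re ≻ 0` (NODE A), potentials (history channel)
    (hAhol : ∀ i j, DifferentiableOn ℂ (fun σ => 𝒦.A2 σ u i j) {σ | ∀ j, σ j ∈ ball (0 : ℂ) (Real.exp (c.κ₁ + 1))})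
    (hGhol : ∀ i j, DifferentiableOn ℂ (fun σ => 𝒦.G2 σ u i j) {σ | ∀ j, σ j ∈ ball (0 : ℂ) (Real.exp (c.κ₁ + 1))})
    (hχm : Measurable χY₀) (hχcm : Measurable χcP) (hVm : ∀ Y, Measurable (Vk Y))
    (hAs : ∀ σ : TPt d N' → ℂ, (∀ j, ‖σ j‖ ≤ Real.exp (c.κ₁ + 1)) → (𝒦.A2 σ u).IsSymm)
    (hA : ∀ σ : TPt d N' → ℂ, (∀ j, ‖σ j‖ ≤ Real.exp (c.κ₁ + 1)) → ((𝒦.A2 σ u).map Complex.re).PosDef)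
    -- the (2.22) shape, and (2.20) on the open PER-DOMAIN τ-region, uniform in `b`
    {γ₂ rP a₂₀ w₂₀ : ℝ} (qP : (𝒦.Λ → ℝ) → ℝ)
    (h222 : ∀ Bf, χY₀ Bf * χcP Bf ≤ Real.exp (-(γ₂ / 2 * rP ^ 2 * (t.2.card : ℕ)) + γ₂ / 2 * qP Bf))
    (hγ₂ : 0 ≤ γ₂) (hqP : ∀ Bf, qP Bf ≤ Bf ⬝ᵥ Bf) (ha0 : 0 ≤ a₂₀)
    (h220U : ∀ τ : TDom d (L * N') → ℂ, (∀ Y, τ Y ∈ Uτ Y) →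
      ∀ Bf, ∑ Y ∈ Dfam, ‖τ Y‖ * ‖Vk Y Bf‖ ≤ a₂₀ / 2 * (Bf ⬝ᵥ Bf) + w₂₀)
    -- a common fibre bound for row and column locations (`𝒦.hfib` bounds the rows by `𝒦.m`)
    {m : ℕ} (hm : 𝒦.m ≤ m) (hfibN : ∀ x : UT Nf, (Finset.univ.filter fun j => 𝒦.locN j = x).card ≤ m)
    -- rates: the record's torus rate `w.κ`, two drops for `Differences216`, two more for the (2.26) chain
    {κa κb kap' kap'' θ : ℝ} (hκa : κa < w.kap) (hκb : κb < κa) (h2 : kap' < κb) (h1 : kap'' < kap')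
    (hkap'' : 0 < kap'')
    -- NODE A's smallness BY NAME: `θ_Γ, θ_E ≤ θ` with `θ_• = 2K̄_•(e^{−εR_σ} + α∕R)` ((v)⁺ of `B13TermWalkDataOneTorus`)
    (hsm : SmallTheta w α θ)
    (hθR1le : (m * (1 + 2 / (κb - kap')) ^ ν) * (m * (1 + 2 / (kap' - kap'')) ^ ν)
      * ((2 * w.KbarΓ * Real.exp (-(w.ε * w.Rσ)) + 2 * w.KbarΓ * α / w.R) * w.KbarC * w.KbarΓ
        + w.KbarΓ * (w.KbarC * (2 * w.KbarE * Real.exp (-(w.ε * w.Rσ)) + 2 * w.KbarE * α / w.R)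
            * (𝒦.m * (1 + 2 / (w.kap - κa)) ^ ν) * w.KbarC * (𝒦.m * (1 + 2 / (κa - κb)) ^ ν)) * w.KbarΓ
        + w.KbarΓ * w.KbarC * (2 * w.KbarΓ * Real.exp (-(w.ε * w.Rσ)) + 2 * w.KbarΓ * α / w.R)) ≤ θ)
    (hsmallKθ : w.KbarC * (m * (1 + 2 / κb) ^ ν) * (θ * (m * (1 + 2 / kap'') ^ ν)) < 1)
    {cE g : ℝ} (hc0 : 0 ≤ cE) (hc : ∀ k, 𝒦.hC.1.eigenvalues k ≤ cE)
    (hαc : (2 * (θ * (m * (1 + 2 / kap'') ^ ν)) + (γ₂ + a₂₀)) * cE ≤ 1 / 2) (hg : 0 ≤ g)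
    (hΓq : ∀ X : 𝒦.Λ ⊕ 𝒦.C₀ → ℝ, (𝒦.Γ₀ *ᵥ X) ⬝ᵥ (𝒦.C *ᵥ (𝒦.Γ₀ *ᵥ X)) ≤ g * (X ⬝ᵥ X))
    (hsmall : (2 * (θ * (m * (1 + 2 / kap'') ^ ν)) + (γ₂ + a₂₀)) * (1 + 2 * cE * g) ≤ 1 / 2)
    {a a₅ : ℝ} (hPa : a ≤ γ₂ * rP ^ 2)
    (hvol : 2 * (w.KbarC * (m * (1 + 2 / κb) ^ ν) * (θ * (m * (1 + 2 / kap'') ^ ν))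
              * (1 + (1 - w.KbarC * (m * (1 + 2 / κb) ^ ν) * (θ * (m * (1 + 2 / kap'') ^ ν)))⁻¹) / 2)
          * (Fintype.card 𝒦.Λ : ℝ)
        + w₂₀ + (2 * (θ * (m * (1 + 2 / kap'') ^ ν)) + (γ₂ + a₂₀)) * cE * (Fintype.card 𝒦.Λ : ℝ)
        + (2 * (θ * (m * (1 + 2 / kap'') ^ ν)) + (γ₂ + a₂₀)) * (1 + 2 * cE * g) * (Fintype.card (𝒦.Λ ⊕ 𝒦.C₀) : ℝ)
        ≤ a₅ * ((Z.1).card : ℝ)) :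
    ‖term214 r lZ lD (core214 (fun σ => 𝒦.A2 σ u) Γ (F214 t.2.card χY₀ χcP Dfam Vk)) 0 0‖ ≤
      weight L M c Z a t * Real.exp (a₅ * ((Z.1).card : ℝ)) := by
  -- the (J1) glue: open σ-region of radius `e^{κ₁+1}` between the two closed polydiscs
  obtain ⟨hUσ, hUexp, hcl⟩ := sigma_region_glue (d := d) (N' := N') c
  have hκb0 : 0 ≤ κb := (hkap''.trans (h1.trans h2)).le
  have hκbw : κb ≤ w.kap := (hκb.trans hκa).le
  have hR0 : 0 < w.R := hα.trans_lt hw.hαR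
  have huR : u ∈ ball (0 : B) w.R := mem_ball_zero_iff.2 (hu.trans_lt hw.hαR)
  -- L17a at `u`, dropped to `κb`; L16a at `u` (NODE A's symmetry ∕ positivity on the closed c⁺-polydisc)
  have h17 : Localisation17a ({ c with κ₁ := c.κ₁ + 1 } : B13.Consts) (fun σ => 𝒦.A2 σ u) (fun σ => 𝒦.G2 σ u)
      𝒦.Γ₀ 𝒦.C 𝒦.locΛ 𝒦.locN κb w.KbarΓ w.KbarΓ w.KbarC w.KbarC :=
    localisation17a_mono_rate hκbw hw.hKbarΓ hw.hKbarΓ hw.hKbarC hw.hKbarC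
      (localisation17a_of_termWalkData hw hα h𝒦 huR)
  have h16 : Differences216 ({ c with κ₁ := c.κ₁ + 1 } : B13.Consts) (fun σ => 𝒦.A2 σ u) (fun σ => 𝒦.G2 σ u)
      𝒦.Γ₀ 𝒦.C 𝒦.locΛ 𝒦.locN κb
      (2 * w.KbarΓ * Real.exp (-(w.ε * w.Rσ)) + 2 * w.KbarΓ * α / w.R)
      (w.KbarC * (2 * w.KbarE * Real.exp (-(w.ε * w.Rσ)) + 2 * w.KbarE * α / w.R)
        * (𝒦.m * (1 + 2 / (w.kap - κa)) ^ ν) * w.KbarC * (𝒦.m * (1 + 2 / (κa - κb)) ^ ν))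
      (2 * w.KbarE * Real.exp (-(w.ε * w.Rσ)) + 2 * w.KbarE * α / w.R) :=
    differences216_of_termWalkData hw hα h𝒦 hκb0 hκb hκa hu hAs hA
  -- non-negativity of the derived letters; NODE A's smallness unfolded
  have hθΓ0 : 0 ≤ 2 * w.KbarΓ * Real.exp (-(w.ε * w.Rσ)) + 2 * w.KbarΓ * α / w.R := by
    have := hw.hKbarΓ; positivity
  have hθE0 : 0 ≤ 2 * w.KbarE * Real.exp (-(w.ε * w.Rσ)) + 2 * w.KbarE * α / w.R := by
    have := hw.hKbarE; positivity
  have hθC0 : 0 ≤ w.KbarC * (2 * w.KbarE * Real.exp (-(w.ε * w.Rσ)) + 2 * w.KbarE * α / w.R)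
      * (𝒦.m * (1 + 2 / (w.kap - κa)) ^ ν) * w.KbarC * (𝒦.m * (1 + 2 / (κa - κb)) ^ ν) := by
    have := hw.hKbarC; have := hw.hKbarE
    have h1' : 0 < w.kap - κa := sub_pos.2 hκa
    have h2' : 0 < κa - κb := sub_pos.2 hκb
    positivity
  have hfibΛ : ∀ x : UT Nf, (Finset.univ.filter fun i => 𝒦.locΛ i = x).card ≤ m := fun x => (𝒦.hfib x).trans hm
  have hθEle : 2 * w.KbarE * Real.exp (-(w.ε * w.Rσ)) + 2 * w.KbarE * α / w.R ≤ θ :=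
    (Eq.trans_le (by ring) hsm.hE)
  have hθΓle : 2 * w.KbarΓ * Real.exp (-(w.ε * w.Rσ)) + 2 * w.KbarΓ * α / w.R ≤ θ :=
    (Eq.trans_le (by ring) hsm.hΓ)
  -- r10's H7 poly-τ capstone at the record's letters (no T21)
  exact h226_torus_of_primitives_holo_polyτ c hκ₁ hα₆ Z t hpos hhalf hUσ hUτ hUexp hUtau hr hr' hsubτ lZ hlZ lD hlD
    (fun σ => 𝒦.A2 σ u) Γ χY₀ χcP hχ0 hχc0 Dfam Vk 𝒦.hC 𝒦.Γ₀ hAhol hχm hχcm hVm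
    (fun σ hσ => hAs σ (hcl σ hσ)) (fun σ hσ => hA σ (hcl σ hσ)) (fun σ => 𝒦.G2 σ u) hGhol hlin qP h222 hγ₂ hqP
    ha0 h220U 𝒦.locΛ 𝒦.locN hfibΛ hfibN hkap'' h1 h2 hθE0 hθΓ0 hθC0 hw.hKbarΓ hw.hKbarΓ hw.hKbarC hw.hKbarC hθEle
    hθΓle hθR1le (fun σ hσ => h17.hG σ (hcl σ hσ)) h17.hΓ₀ (fun σ hσ => h17.hCs σ (hcl σ hσ)) h17.hC216
    (fun σ hσ => h16.hdΓ σ (hcl σ hσ)) (fun σ hσ => h16.hdC σ (hcl σ hσ)) (fun σ hσ => h16.hdE σ (hcl σ hσ))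
    hsmallKθ hc0 hc hαc hg hΓq hsmall hPa hvol

end Summit.QuantumFields.BalabanUV.T4Continuum.Spine.NE5.TwoRunTorusWalkH226

end
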